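import Mathlib
import Literature.NumberTheory.EllipticCurves.Smith2016.CongruentNumberGenusDeterminantRowTwoHolds
import Literature.NumberTheory.EllipticCurves.Smith2016.CongruentNumberGenusDeterminantRowThreeHolds
import Literature.NumberTheory.EllipticCurves.TianYuanZhang2017.GenusDescentBrackets

/-!
# Tian–Yuan–Zhang's second genus sum `Σ₂'(n)` for `n ≡ 6 (mod 8)`, regrouped over index blocks (Smith's `ℒ₆`)

For `n = 2p₁⋯p_k` with distinct odd primes `pᵢ` and `∏ pᵢ ≡ 3 (mod 4)` (`n ≡ 6 (mod 8)`), Tian–Yuan–Zhang's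
second genus sum [TianYuanZhang2017, Thm. 1.2 as printed; the tree's `genusSum₂'`]
`Σ₂'(n) = Σ_{n = d₀⋯d_ℓ, d₀ ≡ 5,6,7 (8), d₁ ≡ 1,2,3 (8), dᵢ ≡ 1 (8) (i>1)} ∏ g(dᵢ)` is, in `𝔽₂`, the sum of
* `Σ_{S ⊆ [k], d_S ≡ 3 (4)} g(2d_S) · ℒ(d_{[k]∖S})` (main block `d₀ = 2d_S ≡ 6 (8)`, all other blocks `≡ 1 (8)`), and
* `Σ_{B ⊆ [k], d_B ≡ 7 (8)} g(d_B) · Σ_{T ⊆ [k]∖B, d_T ≡ 1 (4)} g(2d_T) · ℒ(d_{[k]∖B∖T})` (main block `d₀ = d_B ≡ 7 (8)`,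
  `d₁ = 2d_T ≡ 2 (8)`, all other blocks `≡ 1 (8)`),
where `d_X = ∏_{i∈X} pᵢ`, `g(d) = #2Cl(ℚ(√−d))` (`W2.gK`) and `ℒ(m) = Σ_{D ∈ decompositions m} ∏_{d∈D} [d ≡ 1 (8)] g(d)`
(`natCast_genusSum₂'_two_mul_eq_six`).  This is the right-hand side of A. Smith's Table 2, row 6
[Smith2016CongruentDensity, Thm. 2.2; source `cnc.tex` l. 100–107]:
`ℒ₆(n) = Σ_{d | n, d ≡ n (16)} g(d)ℒ(n/d) + Σ_{d₀d₁ | n, d₀ ≡ 7n (16), d₁ ≡ 7 (8)} g(d₀)g(d₁)ℒ(n/d₀d₁)`, written over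
index blocks; the two shapes are the brackets `B₆`, `B₇` of the tree's `TianYuanZhang2017.W2` (the other main-block
types vanish for `n ≡ 6 (8)`, `W2.bFivePlain_eq_zero_of_six`, `W2.bFiveI_eq_zero_of_six`), and
`W2.mainBlock_cases` supplies the residues of the companion blocks.  Pure finite combinatorics:
* `sum_decompositions_two_mul_blockProd_eq` — decompositions of `2·d_R` grouped by the block containing `2`;
* `natCast_bSix_eq_sum_prod`, `natCast_bSeven_eq_sum_pointed` — the brackets as (pointed) product weights;
* `natCast_bSeven_two_mul_eq_sum_powerset` — the pointed sum regrouped over the distinguished odd block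
  (anchors `t_j = (−1/p_j)₊`: a block `≡ 7 (8)` has `Σ t_j = 1`).
Consumed by `CongruentNumberGenusDeterminantRowSix` (Smith's Thm. 2.2 row 6, every `k`).
-/

namespace Literature.NumberTheory.EllipticCurves.Smith2016

open Finset
open Literature.NumberTheory.EllipticCurves.HeathBrown1994
open Literature.NumberTheory.EllipticCurves.TianYuanZhang2017
open Literature.NumberTheory.EllipticCurves.TianYuanZhang2017.W2
open Literature.NumberTheory.EllipticCurves.MonskySelmerParity
open Literature.LinearAlgebra.Matrix (sum_sum_powerset_erase_insert erase_sdiff_eq_sdiff_insert)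

variable {k : ℕ} (p : Fin k → ℕ)

section BlockArith

/-- `Σ_T tᵢ = [d_T ≢ 1 (4)]` for every block `T` of a tuple of distinct odd primes (`tᵢ = (−1/pᵢ)₊`).
[cite: HeathBrown1994SelmerCongruentII, Appendix (Monsky), typescript p. 39 L36–L37 ("Σ uᵢ = 0 iff D ≡ 1 (mod 4)")] -/
theorem sum_addLegendreSym_neg_one_block_eq (hp : ∀ i, (p i).Prime) (hodd : ∀ i, Odd (p i))
    (T : Finset (Fin k)) :
    ∑ i ∈ T, addLegendreSym (-1) (p i) = if (∏ i ∈ T, p i) % 4 = 1 then 0 else 1 := by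
  set q : Fin T.card → ℕ := fun x => p ((T.equivFin.symm x : {i // i ∈ T}) : Fin k) with hq
  have hqp : ∀ x, (q x).Prime := fun x => hp _
  have hq2 : ∀ x, q x ≠ 2 := ne_two_of_odd q (fun x => hodd _)
  rw [← sum_subtuple p T (fun n => addLegendreSym (-1) n), sum_addLegendreSym_neg_one_eq q hqp hq2,
    prod_subtuple p T]

/-- Block products of odd primes are odd. [cite: HeathBrown1994SelmerCongruentII, Appendix (Monsky), typescript p. 39 L10 (D odd square-free)] -/
theorem blockProd_mod_two (hp : ∀ i, (p i).Prime) (hodd : ∀ i, Odd (p i)) (T : Finset (Fin k)) :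
    (∏ i ∈ T, p i) % 2 = 1 := by
  set q : Fin T.card → ℕ := fun x => p ((T.equivFin.symm x : {i // i ∈ T}) : Fin k) with hq
  have hqp : ∀ x, (q x).Prime := fun x => hp _
  have hq2 : ∀ x, q x ≠ 2 := ne_two_of_odd q (fun x => hodd _)
  rw [← prod_subtuple p T]
  exact Nat.odd_iff.mp (MonskySelmerParity.odd_prod q hqp hq2)

end BlockArith

section EvenAnchor

/-- `succ(R)`-blocks of the tuple `(2; p)` have product `∏_R pⱼ`. [cite: LiMa2008, Lemma 0.1 (p. 279: the primes of D = −8d)] -/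
theorem prod_map_succ_cons_two (R : Finset (Fin k)) :
    ∏ i ∈ R.map ⟨Fin.succ, Fin.succ_injective k⟩, (Fin.cons 2 p : Fin (k + 1) → ℕ) i = ∏ j ∈ R, p j := by
  rw [prod_map]
  simp only [Function.Embedding.coeFn_mk, Fin.cons_succ]

/-- **Decompositions of `2·d_R` grouped by the block containing `2`**: for every block `R ⊆ [k]` and every weight
`W`, `Σ_{D ∈ decompositions(2 d_R)} ∏_{d∈D} W(d) = Σ_{T ⊆ R} W(2 d_T) · Σ_{D′ ∈ decompositions(d_{R∖T})} ∏_{d∈D′} W(d)`.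
[cite: Smith2016CongruentDensity, §2 Table 2 rows 2 and 6 (the even divisor d₀ of n) with Definition of ℒ, (eq:n1rec)] [cite: TianYuanZhang2017, Thm. 1.2 (non-ordered decompositions)] -/
theorem sum_decompositions_two_mul_blockProd_eq {R' : Type*} [CommSemiring R'] (hp : ∀ i, (p i).Prime)
    (hodd : ∀ i, Odd (p i)) (hinj : Function.Injective p) (W : ℕ → R') (R : Finset (Fin k)) :
    ∑ D ∈ decompositions (2 * ∏ i ∈ R, p i), ∏ d ∈ D, W d =
      ∑ T ∈ R.powerset, W (2 * ∏ i ∈ T, p i) *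
        ∑ D ∈ decompositions (∏ i ∈ R \ T, p i), ∏ d ∈ D, W d := by
  have hq := prime_cons_two p hp
  have hqinj := injective_cons_two p hodd hinj
  set e : Fin k ↪ Fin (k + 1) := ⟨Fin.succ, Fin.succ_injective k⟩ with he
  have h0 : (0 : Fin (k + 1)) ∉ R.map e := by
    intro h
    rw [mem_map] at h
    obtain ⟨j, -, hj⟩ := h
    exact Fin.succ_ne_zero j hj
  rw [← prod_insert_zero_map_succ p R,
    sum_decompositions_blockProd_rec (Fin.cons 2 p) hq hqinj W (mem_insert_self (0 : Fin (k + 1)) (R.map e)),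
    erase_insert h0, sum_powerset_map_succ]
  refine sum_congr rfl fun T _ => ?_
  rw [prod_insert_zero_map_succ p T, ← he, ← Finset.map_sdiff, prod_map_succ_cons_two p (R \ T)]

end EvenAnchor

section Brackets

open scoped Classical

/-- The row-6 product weight: `W₁(d) = g(d)` if `d ≡ 1` or `6 (mod 8)`, else `0` (main block `≡ 6`, others `≡ 1`).
[cite: TianYuanZhang2017, Thm. 1.2 (Σ₂' for n ≡ 6 (8): d₀ ≡ 6, dᵢ ≡ 1)] -/
theorem natCast_bSix_summand_eq {n : ℕ} (h6 : n % 8 = 6) {D : Finset ℕ} (hD : D ∈ decompositions n) :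
    ((∑ d₀ ∈ D.filter (fun d₀ => MainBlock D d₀), (if QSix D d₀ then ∏ d ∈ D, gK d else 0) : ℕ) : ZMod 2) =
      ∏ d ∈ D, (if d % 8 = 1 then ((gK d : ℕ) : ZMod 2) else if d % 8 = 6 then ((gK d : ℕ) : ZMod 2) else 0) := by
  rw [sum_mainBlock_ite]
  obtain ⟨dₑ, hdₑ, h2dₑ, huniq⟩ := exists_unique_even_of_mem_decompositions (n := n) (Nat.dvd_of_mod_eq_zero (by omega)) hD
  by_cases hP : ∃ d₀ ∈ D, MainBlock D d₀ ∧ QSix D d₀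
  · rw [if_pos hP, Nat.cast_prod]
    obtain ⟨d₀, hd₀, hM, hQ⟩ := hP
    have hQ6 : d₀ % 8 = 6 := hQ
    have hothers : ∀ d ∈ D, d ≠ d₀ → d % 8 = 1 := by
      rcases mainBlock_cases hD hd₀ hM with ⟨-, h⟩ | ⟨e, -, -, he23, hne, -⟩
      · exact h
      · exfalso; rw [hQ6] at hne; rcases he23 with h | h <;> rw [h] at hne <;> omega
    refine prod_congr rfl fun d hd => ?_
    by_cases hdd : d = d₀
    · rw [hdd, if_neg (by omega), if_pos hQ6]
    · rw [if_pos (hothers d hd hdd)]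
  · rw [if_neg hP, Nat.cast_zero]
    -- some block has weight zero, else the even block would be a main block `≡ 6`
    by_contra hne
    have hall : ∀ d ∈ D, d % 8 = 1 ∨ d % 8 = 6 := by
      intro d hd
      by_contra hd'
      push Not at hd'
      apply hne
      exact (prod_eq_zero hd (by rw [if_neg hd'.1, if_neg hd'.2])).symm
    have hdₑ6 : dₑ % 8 = 6 := by rcases hall dₑ hdₑ with h | h <;> omega
    have hothers : ∀ d ∈ D, d ≠ dₑ → d % 8 = 1 := by
      intro d hd hdd
      rcases hall d hd with h | h
      · exact h
      · exact absurd (huniq d hd (Nat.dvd_of_mod_eq_zero (by omega))) hdd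
    apply hP
    refine ⟨dₑ, hdₑ, ⟨Or.inr (Or.inl hdₑ6), fun d hd hdd => Or.inl (hothers d hd hdd), ?_⟩, hdₑ6⟩
    rw [Finset.card_le_one]
    intro a ha b hb
    rw [mem_filter, mem_erase] at ha hb
    exact absurd (hothers a ha.1.2 ha.1.1) ha.2

/-- **The bracket `B₆` as a product weight**: for `n ≡ 6 (mod 8)`,
`B₆(n) ≡ Σ_{D ∈ decompositions n} ∏_{d∈D} W₁(d) (mod 2)`, `W₁(d) = [d ≡ 1 ∨ d ≡ 6 (8)] g(d)`.
[cite: TianYuanZhang2017, Thm. 1.2 and proof of Thm. 3.5 (2) (p0020 L153–L155: the bracket with d₀ ≡ 6)] -/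
theorem natCast_bSix_eq_sum_prod {n : ℕ} (h6 : n % 8 = 6) :
    ((bSix n : ℕ) : ZMod 2) = ∑ D ∈ decompositions n, ∏ d ∈ D,
      (if d % 8 = 1 then ((gK d : ℕ) : ZMod 2) else if d % 8 = 6 then ((gK d : ℕ) : ZMod 2) else 0) := by
  rw [bSix, coef, Nat.cast_sum]
  exact sum_congr rfl fun D hD => natCast_bSix_summand_eq h6 hD

/-- The row-6 pointed weight: for `n ≡ 6 (8)` and `d₀ ∈ D ∈ decompositions n`, `d₀` is a main block `≡ 7 (8)`
exactly when `d₀ ≡ 7 (8)` and every other block is `≡ 1` or `≡ 2 (mod 8)`; the bracket summand is then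
`ν₇(d₀) · ∏_{d ≠ d₀} W₂(d)` with `ν₇(d) = [d ≡ 7 (8)] g(d)`, `W₂(d) = [d ≡ 1 ∨ d ≡ 2 (8)] g(d)`.
[cite: TianYuanZhang2017, Thm. 1.2 and proof of Thm. 3.5 (2) (p0020 L155–L158: the bracket with d₀ ≡ 7)] -/
theorem natCast_bSeven_summand_eq {n : ℕ} (h6 : n % 8 = 6) {D : Finset ℕ} (hD : D ∈ decompositions n)
    {d₀ : ℕ} (hd₀ : d₀ ∈ D) :
    ((if MainBlock D d₀ ∧ QSeven D d₀ then ∏ d ∈ D, gK d else 0 : ℕ) : ZMod 2) =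
      (if d₀ % 8 = 7 then ((gK d₀ : ℕ) : ZMod 2) else 0) *
        ∏ d ∈ D.erase d₀, (if d % 8 = 1 then ((gK d : ℕ) : ZMod 2) else if d % 8 = 2 then ((gK d : ℕ) : ZMod 2) else 0) := by
  obtain ⟨dₑ, hdₑ, h2dₑ, huniq⟩ := exists_unique_even_of_mem_decompositions (n := n) (Nat.dvd_of_mod_eq_zero (by omega)) hD
  by_cases hP : MainBlock D d₀ ∧ QSeven D d₀
  · have hM := hP.1
    have hQ7 : d₀ % 8 = 7 := hP.2
    rw [if_pos hP, if_pos hQ7, Nat.cast_prod, ← mul_prod_erase D (fun d => ((gK d : ℕ) : ZMod 2)) hd₀]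
    congr 1
    rcases mainBlock_cases hD hd₀ hM with ⟨h, -⟩ | ⟨e, heD, hne, he23, hne8, hrest⟩
    · omega
    · have he2 : e % 8 = 2 := by
        rw [hQ7] at hne8; rcases he23 with h | h <;> rw [h] at hne8 <;> omega
      refine prod_congr rfl fun d hd => ?_
      have hdd : d ≠ d₀ := ne_of_mem_erase hd
      by_cases hde : d = e
      · rw [hde, if_neg (by omega), if_pos he2]
      · rw [if_pos (hrest d (mem_of_mem_erase hd) hdd hde)]
  · rw [if_neg hP, Nat.cast_zero]
    by_cases h7 : d₀ % 8 = 7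
    · rw [if_pos h7]
      -- some other block has weight zero, else `d₀` would be a main block `≡ 7`
      by_contra hne
      have hall : ∀ d ∈ D.erase d₀, d % 8 = 1 ∨ d % 8 = 2 := by
        intro d hd
        by_contra hd'
        push Not at hd'
        apply hne
        rw [prod_eq_zero hd (by rw [if_neg hd'.1, if_neg hd'.2]), mul_zero]
      apply hP
      refine ⟨⟨Or.inr (Or.inr h7), fun d hd hdd => ?_, ?_⟩, h7⟩
      · rcases hall d (mem_erase.mpr ⟨hdd, hd⟩) with h | h
        · exact Or.inl h
        · exact Or.inr (Or.inl h)
      · rw [Finset.card_le_one]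
        intro a ha b hb
        rw [mem_filter] at ha hb
        have ha2 : a % 8 = 2 := by rcases hall a ha.1 with h | h <;> omega
        have hb2 : b % 8 = 2 := by rcases hall b hb.1 with h | h <;> omega
        rw [huniq a (mem_of_mem_erase ha.1) (Nat.dvd_of_mod_eq_zero (by omega)),
          huniq b (mem_of_mem_erase hb.1) (Nat.dvd_of_mod_eq_zero (by omega))]
    · rw [if_neg h7, zero_mul]

/-- **The bracket `B₇` as a pointed product weight**: for `n ≡ 6 (mod 8)`,
`B₇(n) ≡ Σ_{D ∈ decompositions n} Σ_{d₀ ∈ D} ν₇(d₀) · ∏_{d ∈ D∖d₀} W₂(d) (mod 2)`.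
[cite: TianYuanZhang2017, Thm. 1.2 and proof of Thm. 3.5 (2) (p0020 L155–L158)] -/
theorem natCast_bSeven_eq_sum_pointed {n : ℕ} (h6 : n % 8 = 6) :
    ((bSeven n : ℕ) : ZMod 2) = ∑ D ∈ decompositions n, ∑ d₀ ∈ D,
      (if d₀ % 8 = 7 then ((gK d₀ : ℕ) : ZMod 2) else 0) *
        ∏ d ∈ D.erase d₀, (if d % 8 = 1 then ((gK d : ℕ) : ZMod 2) else if d % 8 = 2 then ((gK d : ℕ) : ZMod 2) else 0) := by
  rw [bSeven, coef, Nat.cast_sum]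
  refine sum_congr rfl fun D hD => ?_
  rw [sum_filter, Nat.cast_sum]
  refine sum_congr rfl fun d₀ hd₀ => ?_
  rw [← natCast_bSeven_summand_eq h6 hD hd₀]
  by_cases hM : MainBlock D d₀
  · rw [if_pos hM]
    by_cases hQ : QSeven D d₀
    · rw [if_pos hQ, if_pos ⟨hM, hQ⟩]
    · rw [if_neg hQ, if_neg (fun h => hQ h.2)]
  · rw [if_neg hM, if_neg (fun h => hM h.1)]

end Brackets

section Blocks

/-- **`B₆` over index blocks**: for `n = 2p₁⋯p_k ≡ 6 (mod 8)`,
`B₆(n) ≡ Σ_{S ⊆ [k], d_S ≡ 3 (4)} g(2d_S) · ℒ(d_{[k]∖S}) (mod 2)`, `ℒ(m) = Σ_{D ∈ decompositions m} ∏ [d ≡ 1 (8)] g(d)`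
(main block `2d_S ≡ 6 (8)`, the others `≡ 1 (8)`; Smith's `Σ_{d | n, d ≡ n (16)} g(d) ℒ(n/d)`).
[cite: TianYuanZhang2017, Thm. 1.2 (Σ₂' for n ≡ 6 (8))] [cite: Smith2016CongruentDensity, Thm. 2.2 / Table 2 row 6 (source cnc.tex l. 100–107)] -/
theorem natCast_bSix_two_mul_eq_sum_powerset (hp : ∀ i, (p i).Prime) (hodd : ∀ i, Odd (p i))
    (hinj : Function.Injective p) (h4 : (∏ i, p i) % 4 = 3) :
    ((bSix (2 * ∏ i, p i) : ℕ) : ZMod 2) =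
      ∑ S ∈ (univ : Finset (Fin k)).powerset,
        (if (∏ i ∈ S, p i) % 4 = 1 then 0 else ((gK (2 * ∏ i ∈ S, p i) : ℕ) : ZMod 2)) *
        ∑ D ∈ decompositions (∏ i ∈ univ \ S, p i), ∏ d ∈ D,
          (if d % 8 = 1 then ((gK d : ℕ) : ZMod 2) else 0) := by
  have h6 : (2 * ∏ i, p i) % 8 = 6 := by omega
  rw [natCast_bSix_eq_sum_prod h6, show (2 * ∏ i, p i) = 2 * ∏ i ∈ (univ : Finset (Fin k)), p i from rfl,
    sum_decompositions_two_mul_blockProd_eq p hp hodd hinj _ univ]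
  refine sum_congr rfl fun S _ => ?_
  congr 1
  · have h2 := blockProd_mod_two p hp hodd S
    rw [if_neg (by omega)]
    by_cases h1 : (∏ i ∈ S, p i) % 4 = 1
    · rw [if_pos h1, if_neg (by omega)]
    · rw [if_neg h1, if_pos (by omega)]
  · refine sum_congr rfl fun D hD => prod_congr rfl fun d hd => ?_
    have hdodd : d % 2 = 1 :=
      odd_of_mem_decompositions (Nat.odd_iff.mpr (blockProd_mod_two p hp hodd _)) hD hd
    by_cases h1 : d % 8 = 1
    · rw [if_pos h1, if_pos h1]
    · rw [if_neg h1, if_neg h1, if_neg (by omega)]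

/-- **Decompositions of `2 d_R` with the row-6 companion weight**: for every block `R`,
`Σ_{D ∈ decompositions(2d_R)} ∏ W₂(d) = Σ_{T ⊆ R, d_T ≡ 1 (4)} g(2d_T) · ℒ(d_{R∖T})` (`W₂(d) = [d ≡ 1 ∨ d ≡ 2 (8)] g(d)`:
the even block is `≡ 2 (8)`, the odd ones `≡ 1 (8)`).
[cite: TianYuanZhang2017, Thm. 1.2 (Σ₂' for n ≡ 6 (8): d₁ ≡ 2, dᵢ ≡ 1)] -/
theorem sum_decompositions_two_mul_companion_eq (hp : ∀ i, (p i).Prime) (hodd : ∀ i, Odd (p i))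
    (hinj : Function.Injective p) (R : Finset (Fin k)) :
    ∑ D ∈ decompositions (2 * ∏ i ∈ R, p i), ∏ d ∈ D,
        (if d % 8 = 1 then ((gK d : ℕ) : ZMod 2) else if d % 8 = 2 then ((gK d : ℕ) : ZMod 2) else 0) =
      ∑ T ∈ R.powerset,
        (if (∏ i ∈ T, p i) % 4 = 1 then ((gK (2 * ∏ i ∈ T, p i) : ℕ) : ZMod 2) else 0) *
        ∑ D ∈ decompositions (∏ i ∈ R \ T, p i), ∏ d ∈ D,
          (if d % 8 = 1 then ((gK d : ℕ) : ZMod 2) else 0) := by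
  rw [sum_decompositions_two_mul_blockProd_eq p hp hodd hinj _ R]
  refine sum_congr rfl fun T _ => ?_
  congr 1
  · have h2 := blockProd_mod_two p hp hodd T
    rw [if_neg (by omega)]
    by_cases h1 : (∏ i ∈ T, p i) % 4 = 1
    · rw [if_pos h1, if_pos (by omega)]
    · rw [if_neg h1, if_neg (by omega)]
  · refine sum_congr rfl fun D hD => prod_congr rfl fun d hd => ?_
    have hdodd : d % 2 = 1 :=
      odd_of_mem_decompositions (Nat.odd_iff.mpr (blockProd_mod_two p hp hodd _)) hD hd
    by_cases h1 : d % 8 = 1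
    · rw [if_pos h1, if_pos h1]
    · rw [if_neg h1, if_neg h1, if_neg (by omega)]

/-- The anchors of the tuple `(2; p)` with weights `(0; t)`: `Σ_{i : (2;p)ᵢ ∣ d} (0;t)ᵢ = Σ_{j : pⱼ ∣ d} tⱼ`.
[cite: Smith2016CongruentDensity, §2.1 Remark 2.3 (the primes of a divisor of the odd part of n)] -/
theorem sum_filter_cons_two_anchor (t : Fin k → ZMod 2) (d : ℕ) :
    ∑ i ∈ univ.filter (fun i => (Fin.cons 2 p : Fin (k + 1) → ℕ) i ∣ d), (Fin.cons 0 t : Fin (k + 1) → ZMod 2) i =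
      ∑ j ∈ univ.filter (fun j => p j ∣ d), t j := by
  rw [sum_filter, sum_filter, Fin.sum_univ_succ]
  simp only [Fin.cons_zero, Fin.cons_succ, ite_self, zero_add]

/-- **A block `≡ 7 (8)` carries anchor weight `Σ t_j = 1`**: for `d ∣ 2p₁⋯p_k`,
`(Σ_{j : p_j ∣ d} t_j) · ν₇(d) = ν₇(d)` with `ν₇(d) = [d ≡ 7 (8)] g(d)`, `t_j = (−1/p_j)₊`.
[cite: HeathBrown1994SelmerCongruentII, Appendix (Monsky), typescript p. 39 L36–L37] [cite: TianYuanZhang2017, Thm. 1.2 (main block d₀ ≡ 7 (8))] -/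
theorem anchoredWeight_seven (hp : ∀ i, (p i).Prime) (hodd : ∀ i, Odd (p i)) (hinj : Function.Injective p)
    {d : ℕ} (hd : d ∣ 2 * ∏ i, p i) :
    (∑ j ∈ univ.filter (fun j => p j ∣ d), addLegendreSym (-1) (p j)) *
        (if d % 8 = 7 then ((gK d : ℕ) : ZMod 2) else 0) =
      if d % 8 = 7 then ((gK d : ℕ) : ZMod 2) else 0 := by
  by_cases h7 : d % 8 = 7
  · rw [if_pos h7]
    have hd' : d ∣ ∏ i ∈ (univ : Finset (Fin k)), p i :=
      (Nat.Coprime.dvd_of_dvd_mul_left (Nat.coprime_two_right.mpr (Nat.odd_iff.mpr (by omega))) hd)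
    have hdB := eq_blockProd_filter_of_dvd p hp hinj univ hd'
    have ht := sum_addLegendreSym_neg_one_block_eq p hp hodd (univ.filter (fun j => p j ∣ d))
    rw [← hdB, if_neg (by omega)] at ht
    rw [ht, one_mul]
  · rw [if_neg h7, mul_zero]

/-- The subsets of `[k+1] ∖ {j+1}` avoiding `0` are the `succ`-images of the subsets of `[k] ∖ {j}`.
[cite: LiMa2008, Lemma 0.1 (p. 279: indexing the odd primes of D = −8d)] -/
theorem filter_powerset_erase_succ_eq (j : Fin k) :
    ((univ : Finset (Fin (k + 1))).erase j.succ).powerset.filter (fun B' => (0 : Fin (k + 1)) ∉ B') =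
      ((univ.erase j).map ⟨Fin.succ, Fin.succ_injective k⟩).powerset := by
  ext B'
  simp only [mem_filter, mem_powerset]
  constructor
  · rintro ⟨hsub, h0⟩ b hb
    rw [mem_map]
    obtain ⟨i, rfl⟩ := Fin.exists_succ_eq.mpr (fun h => h0 (h ▸ hb))
    refine ⟨i, mem_erase.mpr ⟨fun hij => ?_, mem_univ i⟩, rfl⟩
    exact (ne_of_mem_erase (hsub hb)) (by rw [hij])
  · intro hsub
    refine ⟨fun b hb => ?_, fun h0 => ?_⟩
    · obtain ⟨i, hi, rfl⟩ := mem_map.mp (hsub hb)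
      exact mem_erase.mpr ⟨fun h => (ne_of_mem_erase hi) (Fin.succ_inj.mp h), mem_univ _⟩
    · obtain ⟨i, -, hi⟩ := mem_map.mp (hsub h0)
      exact Fin.succ_ne_zero i hi

/-- `([k+1] ∖ {j+1}) ∖ succ(B₀) = {0} ∪ succ(([k] ∖ {j}) ∖ B₀)`. [cite: LiMa2008, Lemma 0.1 (p. 279)] -/
theorem erase_succ_sdiff_map_eq (j : Fin k) (B₀ : Finset (Fin k)) :
    ((univ : Finset (Fin (k + 1))).erase j.succ) \ B₀.map ⟨Fin.succ, Fin.succ_injective k⟩ =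
      insert 0 (((univ.erase j) \ B₀).map ⟨Fin.succ, Fin.succ_injective k⟩) := by
  ext b
  rw [mem_sdiff, mem_erase, mem_insert, mem_map, mem_map]
  constructor
  · rintro ⟨⟨hbj, -⟩, hnot⟩
    by_cases hb0 : b = 0
    · exact Or.inl hb0
    · obtain ⟨i, rfl⟩ := Fin.exists_succ_eq.mpr hb0
      refine Or.inr ⟨i, mem_sdiff.mpr ⟨mem_erase.mpr ⟨fun h => hbj (by rw [h]), mem_univ i⟩,
        fun hi => hnot ⟨i, hi, rfl⟩⟩, rfl⟩
  · rintro (rfl | ⟨i, hi, rfl⟩)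
    · refine ⟨⟨fun h => Fin.succ_ne_zero j h.symm, mem_univ _⟩, ?_⟩
      rintro ⟨i, -, h⟩
      exact Fin.succ_ne_zero i h
    · rw [mem_sdiff, mem_erase] at hi
      refine ⟨⟨fun h => hi.1.1 (Fin.succ_inj.mp h), mem_univ _⟩, ?_⟩
      rintro ⟨i', hi', h⟩
      have : i' = i := Fin.succ_inj.mp h
      exact hi.2 (this ▸ hi')

end Blocks

section SevenBlocks

/-- **Decompositions of `2p₁⋯p_k` pointed at the block of `p_j`, row-6 weights**: for every `j`,
`Σ_{D ∈ decompositions(2∏pᵢ)} ∏_{d∈D} (if p_j ∣ d then ν₇(d) else W₂(d)) =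
Σ_{B₀ ⊆ [k]∖j} ν₇(d_{j ∪ B₀}) · Σ_{D′ ∈ decompositions(2 d_{[k]∖j∖B₀})} ∏ W₂` (the block of `p_j` cannot contain `2`:
`ν₇` vanishes on even numbers). [cite: TianYuanZhang2017, Thm. 1.2 (main block d₀ ≡ 7 (8) odd)] [cite: Smith2016CongruentDensity, §2 Definition of ℒ, (eq:n1rec) ("if p is any prime divisor of n")] -/
theorem sum_decompositions_two_mul_anchor_eq (hp : ∀ i, (p i).Prime) (hodd : ∀ i, Odd (p i))
    (hinj : Function.Injective p) (j : Fin k) :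
    ∑ D ∈ decompositions (2 * ∏ i, p i), ∏ d ∈ D,
        (if p j ∣ d then (if d % 8 = 7 then ((gK d : ℕ) : ZMod 2) else 0)
          else (if d % 8 = 1 then ((gK d : ℕ) : ZMod 2) else if d % 8 = 2 then ((gK d : ℕ) : ZMod 2) else 0)) =
      ∑ B₀ ∈ (univ.erase j).powerset,
        (if (∏ i ∈ insert j B₀, p i) % 8 = 7 then ((gK (∏ i ∈ insert j B₀, p i) : ℕ) : ZMod 2) else 0) *
        ∑ D ∈ decompositions (2 * ∏ i ∈ (univ.erase j) \ B₀, p i), ∏ d ∈ D,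
          (if d % 8 = 1 then ((gK d : ℕ) : ZMod 2) else if d % 8 = 2 then ((gK d : ℕ) : ZMod 2) else 0) := by
  have hq := prime_cons_two p hp
  have hqinj := injective_cons_two p hodd hinj
  set e : Fin k ↪ Fin (k + 1) := ⟨Fin.succ, Fin.succ_injective k⟩ with he
  have hprodq : ∏ i ∈ (univ : Finset (Fin (k + 1))), (Fin.cons 2 p : Fin (k + 1) → ℕ) i = 2 * ∏ i, p i :=
    prod_cons_two_eq p
  rw [← hprodq, sum_decompositions_blockProd_rec (Fin.cons 2 p) hq hqinj _ (mem_univ j.succ),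
    ← sum_filter_add_sum_filter_not _ (fun B' => (0 : Fin (k + 1)) ∈ B')]
  -- the blocks containing `2` do not contribute
  have hzero : ∑ B' ∈ ((univ : Finset (Fin (k + 1))).erase j.succ).powerset.filter (fun B' => (0 : Fin (k + 1)) ∈ B'),
      (if p j ∣ ∏ i ∈ insert j.succ B', (Fin.cons 2 p : Fin (k + 1) → ℕ) i then
          (if (∏ i ∈ insert j.succ B', (Fin.cons 2 p : Fin (k + 1) → ℕ) i) % 8 = 7 then
            ((gK (∏ i ∈ insert j.succ B', (Fin.cons 2 p : Fin (k + 1) → ℕ) i) : ℕ) : ZMod 2) else 0)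
        else (if (∏ i ∈ insert j.succ B', (Fin.cons 2 p : Fin (k + 1) → ℕ) i) % 8 = 1 then
            ((gK (∏ i ∈ insert j.succ B', (Fin.cons 2 p : Fin (k + 1) → ℕ) i) : ℕ) : ZMod 2)
          else if (∏ i ∈ insert j.succ B', (Fin.cons 2 p : Fin (k + 1) → ℕ) i) % 8 = 2 then
            ((gK (∏ i ∈ insert j.succ B', (Fin.cons 2 p : Fin (k + 1) → ℕ) i) : ℕ) : ZMod 2) else 0)) *
        ∑ D ∈ decompositions (∏ i ∈ ((univ : Finset (Fin (k + 1))).erase j.succ) \ B',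
            (Fin.cons 2 p : Fin (k + 1) → ℕ) i), ∏ d ∈ D,
          (if p j ∣ d then (if d % 8 = 7 then ((gK d : ℕ) : ZMod 2) else 0)
            else (if d % 8 = 1 then ((gK d : ℕ) : ZMod 2) else if d % 8 = 2 then ((gK d : ℕ) : ZMod 2) else 0)) = 0 := by
    refine sum_eq_zero fun B' hB' => ?_
    rw [mem_filter] at hB'
    have hpj : p j ∣ ∏ i ∈ insert j.succ B', (Fin.cons 2 p : Fin (k + 1) → ℕ) i := by
      have h := dvd_prod_of_mem (Fin.cons 2 p : Fin (k + 1) → ℕ) (mem_insert_self j.succ B')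
      rwa [Fin.cons_succ] at h
    have h2 : 2 ∣ ∏ i ∈ insert j.succ B', (Fin.cons 2 p : Fin (k + 1) → ℕ) i := by
      have h0 : (0 : Fin (k + 1)) ∈ insert j.succ B' := mem_insert_of_mem hB'.2
      have h := dvd_prod_of_mem (Fin.cons 2 p : Fin (k + 1) → ℕ) h0
      rwa [Fin.cons_zero] at h
    rw [if_pos hpj, if_neg (by omega), zero_mul]
  rw [hzero, zero_add, filter_powerset_erase_succ_eq j, sum_powerset_map_succ]
  refine sum_congr rfl fun B₀ hB₀ => ?_
  rw [mem_powerset] at hB₀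
  have hins : insert j.succ (B₀.map e) = (insert j B₀).map e := by
    rw [Finset.map_insert]; rfl
  have hsub : B₀.map e ⊆ (univ : Finset (Fin (k + 1))).erase j.succ := by
    intro b hb
    obtain ⟨i, hi, rfl⟩ := mem_map.mp hb
    exact mem_erase.mpr ⟨fun h => (ne_of_mem_erase (hB₀ hi)) (Fin.succ_inj.mp h), mem_univ _⟩
  rw [← he, hins, prod_map_succ_cons_two p, if_pos (dvd_prod_of_mem p (mem_insert_self j B₀)),
    erase_succ_sdiff_map_eq j B₀, prod_insert_zero_map_succ p]
  congr 1
  refine sum_congr rfl fun D' hD' => prod_congr rfl fun d hd => ?_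
  have hD'' : D' ∈ decompositions (∏ i ∈ ((univ : Finset (Fin (k + 1))).erase j.succ) \ B₀.map e,
      (Fin.cons 2 p : Fin (k + 1) → ℕ) i) := by
    rw [erase_succ_sdiff_map_eq j B₀, prod_insert_zero_map_succ p]; exact hD'
  have hnd := (insert_blockProd_mem_decompositions (Fin.cons 2 p) hq hqinj (mem_univ j.succ) hsub hD'').2.1 d hd
  rw [Fin.cons_succ] at hnd
  rw [if_neg hnd]

/-- **`B₇` over index blocks**: for `n = 2p₁⋯p_k ≡ 6 (mod 8)`,
`B₇(n) ≡ Σ_{B ⊆ [k], d_B ≡ 7 (8)} g(d_B) · Σ_{T ⊆ [k]∖B, d_T ≡ 1 (4)} g(2d_T) · ℒ(d_{[k]∖B∖T}) (mod 2)`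
(main block `d_B ≡ 7 (8)`, companion `2d_T ≡ 2 (8)`, the others `≡ 1 (8)`; Smith's
`Σ_{d₀d₁ | n, d₀ ≡ 7n (16), d₁ ≡ 7 (8)} g(d₀)g(d₁)ℒ(n/d₀d₁)`).  The pointed sum over `d₀ ∈ D` is regrouped over the
distinguished block through the anchors `t_j = (−1/p_j)₊` (a block `≡ 7 (8)` has `Σ_B t_j = 1`).
[cite: TianYuanZhang2017, Thm. 1.2 (Σ₂' for n ≡ 6 (8))] [cite: Smith2016CongruentDensity, Thm. 2.2 / Table 2 row 6 (source cnc.tex l. 100–107)] -/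
theorem natCast_bSeven_two_mul_eq_sum_powerset (hp : ∀ i, (p i).Prime) (hodd : ∀ i, Odd (p i))
    (hinj : Function.Injective p) (h4 : (∏ i, p i) % 4 = 3) :
    ((bSeven (2 * ∏ i, p i) : ℕ) : ZMod 2) =
      ∑ B ∈ (univ : Finset (Fin k)).powerset,
        (if (∏ i ∈ B, p i) % 8 = 7 then ((gK (∏ i ∈ B, p i) : ℕ) : ZMod 2) else 0) *
        ∑ T ∈ (univ \ B).powerset,
          (if (∏ i ∈ T, p i) % 4 = 1 then ((gK (2 * ∏ i ∈ T, p i) : ℕ) : ZMod 2) else 0) *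
          ∑ D ∈ decompositions (∏ i ∈ (univ \ B) \ T, p i), ∏ d ∈ D,
            (if d % 8 = 1 then ((gK d : ℕ) : ZMod 2) else 0) := by
  have hq := prime_cons_two p hp
  have hqinj := injective_cons_two p hodd hinj
  have hprodq : ∏ i, (Fin.cons 2 p : Fin (k + 1) → ℕ) i = 2 * ∏ i, p i := prod_cons_two_eq p
  have h6 : (2 * ∏ i, p i) % 8 = 6 := by omega
  rw [natCast_bSeven_eq_sum_pointed h6]
  -- (1) per decomposition: the pointed sum is an anchored sum over the tuple `(2; p)` with anchor weights `(0; t)`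
  have step1 : ∀ D ∈ decompositions (2 * ∏ i, p i),
      ∑ d₀ ∈ D, (if d₀ % 8 = 7 then ((gK d₀ : ℕ) : ZMod 2) else 0) *
        ∏ d ∈ D.erase d₀, (if d % 8 = 1 then ((gK d : ℕ) : ZMod 2) else if d % 8 = 2 then ((gK d : ℕ) : ZMod 2) else 0) =
      ∑ i, (Fin.cons 0 (fun j => addLegendreSym (-1) (p j)) : Fin (k + 1) → ZMod 2) i *
        ∏ d ∈ D, (if (Fin.cons 2 p : Fin (k + 1) → ℕ) i ∣ d then (if d % 8 = 7 then ((gK d : ℕ) : ZMod 2) else 0)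
          else (if d % 8 = 1 then ((gK d : ℕ) : ZMod 2) else if d % 8 = 2 then ((gK d : ℕ) : ZMod 2) else 0)) := by
    intro D hD
    have hD' : D ∈ decompositions (∏ i, (Fin.cons 2 p : Fin (k + 1) → ℕ) i) := by rwa [hprodq]
    rw [sum_mul_prod_anchored (Fin.cons 2 p) hq hqinj _ _ _ hD']
    refine sum_congr rfl fun d₀ hd₀ => ?_
    have hdvd : d₀ ∣ 2 * ∏ i, p i := (Nat.mem_divisors.mp ((mem_decompositions_iff.mp hD).1 hd₀)).1
    rw [sum_filter_cons_two_anchor, ← mul_assoc, anchoredWeight_seven p hp hodd hinj hdvd]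
  rw [sum_congr rfl step1, sum_comm]
  simp only [← mul_sum]
  rw [Fin.sum_univ_succ]
  simp only [Fin.cons_zero, zero_mul, zero_add, Fin.cons_succ]
  -- (2) per anchor `j`: regroup over the block of `p_j`, then split the even block off the rest
  rw [sum_congr rfl fun j _ => by rw [sum_decompositions_two_mul_anchor_eq p hp hodd hinj j]]
  -- (3) the right-hand side, anchored the same way
  have hrhs : ∀ B ∈ (univ : Finset (Fin k)).powerset,
      (if (∏ i ∈ B, p i) % 8 = 7 then ((gK (∏ i ∈ B, p i) : ℕ) : ZMod 2) else 0) *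
        ∑ T ∈ (univ \ B).powerset,
          (if (∏ i ∈ T, p i) % 4 = 1 then ((gK (2 * ∏ i ∈ T, p i) : ℕ) : ZMod 2) else 0) *
          ∑ D ∈ decompositions (∏ i ∈ (univ \ B) \ T, p i), ∏ d ∈ D,
            (if d % 8 = 1 then ((gK d : ℕ) : ZMod 2) else 0) =
      ∑ j ∈ B, addLegendreSym (-1) (p j) *
        ((if (∏ i ∈ B, p i) % 8 = 7 then ((gK (∏ i ∈ B, p i) : ℕ) : ZMod 2) else 0) *
          ∑ D ∈ decompositions (2 * ∏ i ∈ univ \ B, p i), ∏ d ∈ D,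
            (if d % 8 = 1 then ((gK d : ℕ) : ZMod 2) else if d % 8 = 2 then ((gK d : ℕ) : ZMod 2) else 0)) := by
    intro B _
    have hdvd : (∏ i ∈ B, p i) ∣ 2 * ∏ i, p i :=
      Dvd.dvd.mul_left (prod_dvd_prod_of_subset _ _ _ (subset_univ B)) 2
    have hfilter : univ.filter (fun j => p j ∣ ∏ i ∈ B, p i) = B := by
      ext j; rw [mem_filter, prime_dvd_blockProd_iff p hp hinj]; simp
    have hw := anchoredWeight_seven p hp hodd hinj hdvd
    rw [hfilter] at hw
    rw [← sum_mul, ← mul_assoc, hw, sum_decompositions_two_mul_companion_eq p hp hodd hinj (univ \ B)]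
  rw [sum_congr rfl hrhs, ← sum_sum_powerset_erase_insert univ
    (fun j B => addLegendreSym (-1) (p j) *
      ((if (∏ i ∈ B, p i) % 8 = 7 then ((gK (∏ i ∈ B, p i) : ℕ) : ZMod 2) else 0) *
        ∑ D ∈ decompositions (2 * ∏ i ∈ univ \ B, p i), ∏ d ∈ D,
          (if d % 8 = 1 then ((gK d : ℕ) : ZMod 2) else if d % 8 = 2 then ((gK d : ℕ) : ZMod 2) else 0)))]
  refine sum_congr rfl fun j _ => ?_
  rw [mul_sum]
  refine sum_congr rfl fun B₀ _ => ?_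
  rw [erase_sdiff_eq_sdiff_insert]

end SevenBlocks

section GenusSumSix

/-- **Tian–Yuan–Zhang's `Σ₂'(n)` for `n = 2p₁⋯p_k ≡ 6 (mod 8)`, over index blocks (= Smith's `ℒ₆(n)`)**:
`Σ₂'(n) ≡ Σ_{S ⊆ [k], d_S ≡ 3 (4)} g(2d_S)·ℒ(d_{[k]∖S}) + Σ_{B ⊆ [k], d_B ≡ 7 (8)} g(d_B)·Σ_{T ⊆ [k]∖B, d_T ≡ 1 (4)} g(2d_T)·ℒ(d_{[k]∖B∖T}) (mod 2)`,
`ℒ(m) = Σ_{D ∈ decompositions m} ∏_{d∈D} [d ≡ 1 (8)] g(d)`, `g(d) = #2Cl(ℚ(√−d))`.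
[cite: TianYuanZhang2017, Thm. 1.2 as printed (Σ₂' for n ≡ 6 (8), chunk p0002 L115–L127)] [cite: Smith2016CongruentDensity, Thm. 2.2 / Table 2 row 6 (source cnc.tex l. 100–107: ℒ₆(n))] -/
theorem natCast_genusSum₂'_two_mul_eq_six (hp : ∀ i, (p i).Prime) (hodd : ∀ i, Odd (p i))
    (hinj : Function.Injective p) (h4 : (∏ i, p i) % 4 = 3) :
    ((genusSum₂' (2 * ∏ i, p i) (fun d => genusClassNumber (GenusField d)) : ℕ) : ZMod 2) =
      ∑ S ∈ (univ : Finset (Fin k)).powerset,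
        (if (∏ i ∈ S, p i) % 4 = 1 then 0
          else ((genusClassNumber (GenusField (2 * ∏ i ∈ S, p i)) : ℕ) : ZMod 2)) *
        ∑ D ∈ decompositions (∏ i ∈ univ \ S, p i), ∏ d ∈ D,
          (if d % 8 = 1 then ((genusClassNumber (GenusField d) : ℕ) : ZMod 2) else 0) +
      ∑ B ∈ (univ : Finset (Fin k)).powerset,
        (if (∏ i ∈ B, p i) % 8 = 7 then ((genusClassNumber (GenusField (∏ i ∈ B, p i)) : ℕ) : ZMod 2) else 0) *
        ∑ T ∈ (univ \ B).powerset,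
          (if (∏ i ∈ T, p i) % 4 = 1 then ((genusClassNumber (GenusField (2 * ∏ i ∈ T, p i)) : ℕ) : ZMod 2)
            else 0) *
          ∑ D ∈ decompositions (∏ i ∈ (univ \ B) \ T, p i), ∏ d ∈ D,
            (if d % 8 = 1 then ((genusClassNumber (GenusField d) : ℕ) : ZMod 2) else 0) := by
  have h6 : (2 * ∏ i, p i) % 8 = 6 := by omega
  rw [show (fun d => genusClassNumber (GenusField d)) = gK from rfl, genusSum₂'_eq_brackets,
    bFivePlain_eq_zero_of_six h6, bFiveI_eq_zero_of_six h6, zero_add, zero_add, Nat.cast_add,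
    natCast_bSix_two_mul_eq_sum_powerset p hp hodd hinj h4, natCast_bSeven_two_mul_eq_sum_powerset p hp hodd hinj h4]
  rfl

end GenusSumSix

end Literature.NumberTheory.EllipticCurves.Smith2016
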